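import Summits.QuantumFields.YangMills.Theorems.FluctuationComparisonRegPrIntLRunpairOrganDischargeInputsHJsqV04Defs
import Summits.QuantumFields.YangMills.Theorems.FluctuationComparisonRegPrIntLOrganTangentJTSqOfHdispCrude
import Summits.QuantumFields.YangMills.Theorems.FluctuationComparisonRegPrIntLRunpairOrganFibreLawJSqDefs
import Summits.QuantumFields.YangMills.Theorems.FluctuationComparisonRegPrIntLOrganTangentJV0OfCornerStability
import Summits.QuantumFields.YangMills.Theorems.FluctuationComparisonRegPrIntLOrganTangentCovSandwichSq
import Summits.QuantumFields.YangMills.Theorems.FluctuationComparisonRegPrIntLOrganTangentJTSqOfHdispNear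
import Summits.QuantumFields.YangMills.Theorems.FluctuationComparisonRegPrIntLOrganTangentLawClausesOfILawSplit
import Summits.QuantumFields.YangMills.Theorems.FluctuationComparisonRegPrIntLOrganTangentLawClausesOfILawAE
import Summits.QuantumFields.YangMills.Theorems.FluctuationComparisonRegPrIntLOrganTangentLawClausesOfILaw
import Summits.QuantumFields.YangMills.Theorems.FluctuationComparisonRegPrIntLOrganTangentLawJClausesOfILaw
import Summits.QuantumFields.YangMills.Theorems.FluctuationComparisonRegPrIntLOrganTangentLawClausesOfILawSq
import Summits.QuantumFields.YangMills.Theorems.FluctuationComparisonRegPrIntLOrganTangentILawKnitFactsSq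
import Summits.QuantumFields.YangMills.Theorems.FluctuationComparisonRegPrIntLOrganTangentFibreWeightNormalisation
import Summits.QuantumFields.YangMills.Theorems.FluctuationComparisonRegPrIntLOrganTangentILawKnitFacts
import Summits.QuantumFields.YangMills.Theorems.FluctuationComparisonRegPrIntLOrganTangentMultiWindowWeight
import Summits.QuantumFields.YangMills.Theorems.FluctuationComparisonRegPrIntLOrganTangentFibreMeanVersionMW
import Summits.QuantumFields.YangMills.Theorems.FluctuationComparisonRegPrIntLOrganTangentAPackageDescendTo
import Summits.QuantumFields.YangMills.Theorems.FluctuationComparisonRegPrIntLRunpairOrganFibreLawDefs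
import Literature.MathematicalPhysics.QuantumFieldTheory.Balaban1983to89.BalabanAdmissibleClassParams
import Literature.MathematicalPhysics.QuantumFieldTheory.Balaban1983to89.T4AveragingDisintegration
import Literature.MathematicalPhysics.QuantumFieldTheory.Balaban1983to89.T4CubeChartExp
import HarnessLib

/-!
# Route `UnitScaleTilt` — crux `FluctuationComparisonRegPrIntL` (stmt-QuantumFields-20520, rung R3), PATH-B organ, sq-programme: «THE ORGAN DISCHARGE KNIT, NEAR-PAIR ("sq") EDITION
# v0.4, THEOREMS-SIDE» — `spreadFibreLawHJsq_of_dischargeInputsSq : OrganDischargeInputsHJsq → SpreadFibreLawHJsq` (row-sq v0.4 = ✓`…RunpairOrganDischargeInputsHJsqV04Defs`)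

Cell `ym3-torus` (YM ladder rung R3 = continuum `SU(2)` Yang–Mills on the three-torus — a RUNG: NOT d = 4, NOT infinite volume, NOT a mass gap, NOT Clay).
Width seat `ym-ust-20520-w4` (gen 25) FILING LEAD-20520 `ym-ust-20520-w3` g27's PROOF: LEAD's knit-sq v0.4 TWIN (HOME `ym-ust-20520-w3/g27/DischargeKnitSq_v04_A5_TWIN.LEADpredict.lean`,
sha16 b776f7332709771b, FARM rc 0 · 0 sorry · axioms trio; its inlined row namespace = the TREE row v0.4's body ws16 d7cc2b2598f430a6, its inlined scratch door = ✓p823618's two statements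
binder-for-binder per LEAD №33) with the inlined row namespace DELETED and the row imported from the reviewed DEFS file ✓`…RunpairOrganDischargeInputsHJsqV04Defs`, the inlined scratch
door namespace DELETED and replaced by `import …FluctuationComparisonRegPrIntLOrganTangentJTSqOfHdispCrude` (px19 g22's A5 door ✓p823618; ONE `open` line re-pointed), and the knit
namespace renamed `…SqV04` — names by LEAD №33 (RULING №52, suffix V04); basis v0.4 by ★★OWNER RULING №96 (E); pure mechanics (script `cut_knit2.py`, proof block byte-kept), as
✓p822362 (V03), ✓p819316 and the v0.1 chain were — with ONE signature token spelled out: the hypothesis type is written FULLY QUALIFIED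
(`Summit.….FluctuationComparisonRegPrIntLRunpairOrganDischargeInputsHJsqV04.OrganDischargeInputsHJsq`) so that the statement's source text names its edition (the gate's `dedup.landed`
key is the statement TEXT, and the V03 edition ✓p822362 reads `(hD : OrganDischargeInputsHJsq) : SpreadFibreLawHJsq` verbatim); the elaborated statement is unchanged.
`--kind proof --supports stmt-QuantumFields-20520 --as helper`, count-neutral, DEFINITION-FREE, no registry ∕ binder ∕ `Lines/` edit, default heartbeats, `autoImplicit false`.

WHAT THIS IS.  The Theorems-side edition of the sq-KNIT on the sq-row OF RECORD v0.4: `OrganDischargeInputsHJsq` (✓`…RunpairOrganDischargeInputsHJsqV04Defs`, namespace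
`…FluctuationComparisonRegPrIntLRunpairOrganDischargeInputsHJsqV04`; row-sq v0.4 = `Cruxes/…/DischargeInputsHJsq.lean` tree sha16 599197e642c5d86c, body ws16 d7cc2b2598f430a6) ⟹
`SpreadFibreLawHJsq` (✓p819394, the NEAR-PAIR currency).  Row-sq v0.4 = v0.3 (✓p822272's text: (I-geo)sq one-bond `hdisp` + cap + room₃, NO far-pair letter; (I-curv) near (A1);
(I-law) A2′ «AE»; (I-cov)sq) + A5 ((I-curv) «CAUCHY ROAD»: letters `kG kB ES Good`, crude second-difference clauses only; `hcurv` ∕ `kP gP KP KP2` gone — LEAD g27 №16∕№22, ★★OWNER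
RULING №91∕№96).  KNIT DELTA vs the V03 edition ✓p822362 (LEAD's twin diff, three hunks, everything else byte-identical): the (I-curv) destructuring loses `kP gP KP KP2 hk hg hKP hKP2`;
the (JT-h)sq kernel witness is `fun B B' => kG B B' + ES * kB B B'` (non-negativity in one term); the (JT-h)sq line is `exact jtBracket_sq_of_hdisp_crude …` — px19 g22's A5 DOOR
✓`…OrganTangentJTSqOfHdispCrude` (the `…_near` door ✓p820521 with its (γ) `hClauseSq_of_curvData` step deleted: the crude clause `hG` on `Good` is consumed as is) — in place of
`jtBracket_sq_of_hdisp_near … kP gP KP KP2 hk hg hKP hKP2 Good hGood hcurv …`.  THE OTHER EIGHT sq LINES are V03's verbatim: (L1ʲ-h)sq ∕ (L2ʲ-h) ∕ (JV3-h′)sq ∕ (JV4-h′)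
`l1jSq_of_ilawAE ∕ l2j_of_ilawAE ∕ jv3Sq_of_ilawAE ∕ jv4_of_ilawAE` (✓p821651, w5 g24, over LEAD's AE doors ✓p821155 ∕ ✓p821396 and ✓p821514 ∕ ✓p821581) with the path facts of
✓p819333 and `hrc_of_sqrt3_mul_le`; (JV0-h)sq `jv0ClauseSq_of_hdisp` (✓p819361 over ✓p819252); (JV1-h)sq ∕ (JV2-h)sq `jv1ClauseSq ∕ jv2ClauseSq_of_covKernel_profiles` (✓p819216);
`exists_height_multiWindowWeight`, `wNum_nonneg`.  The theorem's own docstring is LEAD's twin text byte-kept.  With ✓p820397 `…OneStepTransportUHOfSpreadFibreLawHJsq.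
oneStepTransportUH_of_spreadFibreLawHJsq` (w4 g24, sq-apex) this gives O1ᵘ-H v2.2 ⟸ `OrganDischargeInputsHJsq` (v0.4) — next file `…OrganTangentOneStepTransportUHOfDischargeInputsHJsqV04`.

HONEST FRAMING: a junction over HYPOTHESIS texts — it proves «ROW-sq v0.4 ⟹ HJsq» and discharges NOTHING of the row; `OrganDischargeInputsHJsq` (v0.4) is EXACTLY AS OPEN as
`SpreadFibreLawHJsq` and as v0.3 (its letters `c Db DP` ∕ `hdisp`, the crude curvature letters `kG kB ES Good`, the (Lip) weight-path facts and the a.e. score kernels, `Prof` ∕ (G)(K•) are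
what a discharger must PROVE from [Balaban1985Variational] Thm 1 ∕ Prop 9, [Balaban1985Averaging] (9)–(13), [Balaban1987RG1] Thm 1 ∕ Thm 3 — SOURCES only); the pointwise-on-`Good`
tangent letter is under the cell's instrument review (FL-36∕FL-37; a fibre-mean edition A5′ may follow — an edition question for HYPOTHESIS text); nothing of Bałaban's analysis is asserted
or proved; `SpreadFibreLawH(J)(sq)` ∕ `OrganDischargeInputsHJ(sq)` (every edition) UNDISCHARGED; S1aᴴ, S3ᴴ, 26243, S2α′, S2β, O1ᵘ-H v2.2 (as a fact), the five registered stubs of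
`Lines/semiclassical_s2beta.lean` (untouched), crux 20520 and `YM3TorusSU2` are NOT proved; rung R3 = SU(2) YM₃ on T³ at fixed lattice data — NOT d = 4, NOT infinite volume, NOT a mass
gap, NOT Clay; the Yang–Mills mass gap is NOT proved.  Credit: LEAD w3 g26∕g27 (the proof, DISCHARGE-SPEC), ideator g29 (rows), px19 g22 (the A5 door), w5 g24∕g25 (the (I-law) lane),
px19 g20∕g21, px20 g21, px5 g21 (the sq doors), desk g44∕g45∕g46.
-/

set_option autoImplicit false

noncomputable section

namespace Summit.QuantumFields.YangMills.Theorems.OrganTangentSpreadFibreLawHJsqOfDischargeInputsSqV04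

open MeasureTheory Filter Topology Function
open scoped ENNReal NNReal BigOperators
open Literature.MathematicalPhysics.QuantumFieldTheory.Balaban1983to89 T3ContinuumYM3Torus T3NestedUnitLaws
  T3UnitLawDensityEML T4Continuum BalabanUVClass T3UnitScaleTilt T3LevelShift T3TiltDescent
open T4CubeChartExp (expPt)
open Summit.QuantumFields.YangMills.Theorems.FluctuationComparisonRegPrIntLRunpairOrganFibreLaw (mwCut wNum wgt)
open Summit.QuantumFields.YangMills.Theorems.FluctuationComparisonRegPrIntLRunpairOrganFibreLawJSq (SpreadFibreLawHJsq)
open Summit.QuantumFields.YangMills.Theorems.FluctuationComparisonRegPrIntLRunpairOrganDischargeInputsHJsqV04 (OrganDischargeInputsHJsq)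
open Summit.QuantumFields.YangMills.Theorems.FluctuationComparisonRegPrIntLOrganTangentMultiWindowWeight (exists_height_multiWindowWeight)
open Summit.QuantumFields.YangMills.Theorems.OrganTangentJV0OfCornerStability (jv0ClauseSq_of_hdisp)
open Summit.QuantumFields.YangMills.Theorems.OrganTangentCovSandwichSq (jv1ClauseSq_of_covKernel_profiles jv2ClauseSq_of_covKernel_profiles)
open Summit.QuantumFields.YangMills.Theorems.OrganTangentJTSqOfHdispCrude (jtBracket_sq_of_hdisp_crude)
open Summit.QuantumFields.YangMills.Theorems.OrganTangentLawClausesOfILawAE (l1jSq_of_ilawAE l2j_of_ilawAE jv3Sq_of_ilawAE jv4_of_ilawAE)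
open Summit.QuantumFields.YangMills.Theorems.OrganTangentFibreWeightNormalisation (wNum_nonneg)
open Summit.QuantumFields.YangMills.Theorems.OrganTangentILawKnitFacts (hrc_of_sqrt3_mul_le)
open Summit.QuantumFields.YangMills.Theorems.OrganTangentILawKnitFactsSq (hpath_l1jSq_of_hdisp hpath_jv3Sq_of_hdisp hsqpath_l2j_of_hdisp hsqpath_jv4_of_hdisp)
open Set (Icc)

/-- ★★★ **THE ORGAN DISCHARGE KNIT, sq EDITION v0.3**: `OrganDischargeInputsHJsq → SpreadFibreLawHJsq` — prefix and chart [0]–[11] pass through; (JT-h)sq by ✓p820521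
`jtBracket_sq_of_hdisp_near` (A1 near (I-curv), law point a corner), (L1ʲ-h)sq∕(L2ʲ-h)∕(JV3-h′)sq∕(JV4-h′) by ✓p821651 `l1jSq∕l2j∕jv3Sq∕jv4_of_ilawAE` (A2′ AE blocks: Lipschitz
only, kernels `∀ᵐ s`; over ✓p821155∕✓p821396∕✓p821514∕✓p821581) + ✓p819333 path facts, (JV0-h)sq by ✓p819361, (JV1-h)sq(JV2-h)sq by ✓p819216 (module docstring).
A junction over hypothesis texts: it discharges nothing of the row. [folklore] -/
theorem spreadFibreLawHJsq_of_dischargeInputsSq (hD : Summit.QuantumFields.YangMills.Theorems.FluctuationComparisonRegPrIntLRunpairOrganDischargeInputsHJsqV04.OrganDischargeInputsHJsq) :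
    SpreadFibreLawHJsq := by
  classical
  unfold SpreadFibreLawHJsq
  obtain ⟨pW, γ₁, hγ₁, hD⟩ := hD
  refine ⟨pW, min γ₁ 1, lt_min hγ₁ one_pos, ?_⟩
  intro F γ hγ hγ1 b₀ p₀ j₀ prm η rA Bρ hb₀ hp₀ hpW hadm hη0 hηs hηss hηt hrA
  have hγone : γ ≤ 1 := hγ1.trans (min_le_right _ _)
  obtain ⟨κ₀, hκ₀, hD⟩ := hD F γ hγ (hγ1.trans (min_le_left _ _)) b₀ p₀ j₀ prm η rA Bρ hb₀ hp₀ hpW hadm hη0 hηs hηss hηt hrA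
  refine ⟨κ₀, hκ₀, ?_⟩
  intro κ hκ hκle
  obtain ⟨rc, w₀, NT, NX, NL, CJ, NV1, NV2, NV3, NV4, δT, δX, δL, δV1, δV2, δV3, δV4, j₁, hrc, hw₀, hNT, hNX, hNL, hCJ,
    hδ0, hδTs, hδTss, hδTt, hδXs, hδXss, hδXt, hδLs, hδLss, hδLt, hVfacts, hj₁, hD⟩ := hD κ hκ hκle
  obtain ⟨jA, hMWA⟩ := exists_height_multiWindowWeight F γ b₀ p₀ hγ hγone hb₀
  refine ⟨rc, w₀, NT, NX, NL, CJ, NV1, NV2, NV3, NV4, δT, δX, δL, δV1, δV2, δV3, δV4, max j₁ jA, hrc, hw₀, hNT, hNX, hNL, hCJ,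
    hδ0, hδTs, hδTss, hδTt, hδXs, hδXss, hδXt, hδLs, hδLss, hδLt, hVfacts, hj₁.trans (le_max_left _ _), ?_⟩
  intro ν hG hCν K K' hKK' Ts T hTs hTK μ μ' ρ ρ' hanch hcut hcons hfin hwin j hj hjTs
  have hj1 : j₁ ≤ j := (le_max_left _ _).trans hj
  have hjA : jA ≤ j := (le_max_right _ _).trans hj
  obtain ⟨Z, instZ, τ, Φ, J, S, π, hτ, hΦm, hJm, hSm, hS, hsec, hdis, hcont, hJle, hpos, hπ1, hπ2, hgeo, hseedgrp⟩ :=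
    hD ν hG hCν K K' hKK' Ts T hTs hTK μ μ' ρ ρ' hanch hcut hcons hfin hwin j hj1 hjTs
  obtain ⟨c, Db, DP, hrc16, hc, hDb0, hDPle, hdisp, hroom3⟩ := hgeo
  -- frame facts
  have hθj : 0 < θBal F.L γ b₀ p₀ j := T3MinimiserStabilityReduction.θBal_pos F.hL.2.le hγ hγone hb₀ p₀ j
  have hθT : 0 < θBal F.L γ b₀ p₀ Ts := T3MinimiserStabilityReduction.θBal_pos F.hL.2.le hγ hγone hb₀ p₀ Ts
  have hθ4 : 0 < θBal F.L γ b₀ p₀ j / 4 := by positivity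
  have hTs₀ : j₀ ≤ Ts := by omega
  have hTsT : Ts ≤ T := hTs.le
  have hposT : ∀ U, PlaqSmall (θBal F.L γ b₀ p₀ Ts) U → 0 < ρ Ts U ∧ 0 < ρ' Ts U := fun U hU => (hwin Ts hTs₀ hTsT).1 U hU
  have hcT : ContinuousOn (ρ Ts) {U | PlaqSmall (θBal F.L γ b₀ p₀ Ts) U} := (hwin Ts hTs₀ hTsT).2.2.2.2.2.2.2.1.1
  have hcT' : ContinuousOn (ρ' Ts) {U | PlaqSmall (θBal F.L γ b₀ p₀ Ts) U} := (hwin Ts hTs₀ hTsT).2.2.2.2.2.2.2.1.2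
  have hmeasT : ∀ (f : GaugeField (F.P Ts) 0 ↥(Matrix.specialUnitaryGroup (Fin 2) ℂ) → ℝ),
      (∃ κ' : ℝ, MemAtHeight F ℰp Ts (prm Ts) (fun U => Real.exp κ' * f U)) → Measurable f := by
    intro f ⟨κ', hκ'⟩
    have hm1 : Measurable (fun U => Real.exp κ' * f U) := hκ'.measurable
    have hm2 : f = fun U => (Real.exp κ')⁻¹ * (Real.exp κ' * f U) := by
      funext U; rw [← mul_assoc, inv_mul_cancel₀ (Real.exp_pos κ').ne', one_mul]
    rw [hm2]; exact hm1.const_mul _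
  have hρm : Measurable (ρ Ts) := hmeasT _ (hwin Ts hTs₀ hTsT).2.2.2.1
  have hρ'm : Measurable (ρ' Ts) := hmeasT _ (hwin Ts hTs₀ hTsT).2.2.2.2.1
  obtain ⟨hχc, hχ0, hχsupp, hχpos⟩ := hMWA j hjA Ts hjTs
  haveI := hτ
  -- knit-side facts for the (I-law) dock
  have hw0 : ∀ (t : ℝ) (V : GaugeField (F.P j) 0 ↥(Matrix.specialUnitaryGroup (Fin 2) ℂ)) (z : Z), 0 ≤ wNum F γ b₀ p₀ j Ts ρ ρ' Φ J t V z :=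
    wNum_nonneg F γ b₀ p₀ j Ts hjTs ρ ρ' hposT hθT hχ0 hχsupp Φ J
  have hΦV : ∀ V : GaugeField (F.P j) 0 ↥(Matrix.specialUnitaryGroup (Fin 2) ℂ), Measurable fun z : Z => Φ (V, z) := fun V => hΦm.comp (measurable_const.prodMk measurable_id)
  have hmF : ∀ V : GaugeField (F.P j) 0 ↥(Matrix.specialUnitaryGroup (Fin 2) ℂ), AEStronglyMeasurable (fun z => Real.log (ρ Ts (Φ (V, z))) - Real.log (ρ' Ts (Φ (V, z)))) τ :=
    fun V => ((Real.measurable_log.comp (hρm.comp (hΦV V))).sub (Real.measurable_log.comp (hρ'm.comp (hΦV V)))).aestronglyMeasurable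
  have hmW : ∀ (t : ℝ) (V : GaugeField (F.P j) 0 ↥(Matrix.specialUnitaryGroup (Fin 2) ℂ)), AEStronglyMeasurable (fun z => wNum F γ b₀ p₀ j Ts ρ ρ' Φ J t V z) τ := by
    intro t V
    haveI : CompactSpace (GaugeField (F.P Ts) 0 ↥(Matrix.specialUnitaryGroup (Fin 2) ℂ)) :=
      inferInstanceAs (CompactSpace (PBond (F.P Ts) 0 → ↥(Matrix.specialUnitaryGroup (Fin 2) ℂ)))
    haveI : BorelSpace (GaugeField (F.P Ts) 0 ↥(Matrix.specialUnitaryGroup (Fin 2) ℂ)) :=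
      Literature.MathematicalPhysics.QuantumFieldTheory.Balaban1983to89.T3OrbitAverage.instBorelSpaceGaugeField
    have hJm1 : Measurable fun z => (J (V, z) : ℝ) := (hJm.comp (measurable_const.prodMk measurable_id)).coe_nnreal_real
    have h1 : Measurable fun z => mwCut F γ b₀ p₀ j Ts (Φ (V, z)) := hχc.measurable.comp (hΦV V)
    have h2 : Measurable fun z => Real.rpow (ρ Ts (Φ (V, z))) t * Real.rpow (ρ' Ts (Φ (V, z))) (1 - t) :=
      ((hρm.comp (hΦV V)).pow_const t).mul ((hρ'm.comp (hΦV V)).pow_const (1 - t))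
    exact ((h1.mul h2).mul hJm1).aestronglyMeasurable
  -- sq PATH-FACTS (✓p819333) from the row's one-bond letter `hdisp` + cap + guard + room₃; (JV0-h)sq by ✓p819361
  have hwin : (1 + 16 * Real.sqrt 3 * rc) * (θBal F.L γ b₀ p₀ j / 4) ≤ θBal F.L γ b₀ p₀ j := hrc_of_sqrt3_mul_le hrc16 hθj.le
  have hPX := hpath_l1jSq_of_hdisp F γ b₀ p₀ j Ts hjTs ρ ρ' hρm hρ'm hcT hcT' hposT hθT hχc hχ0 hχsupp hχpos τ Φ J hΦm hJm CJ hJle hpos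
    c hc hθj Db rc hrc.le hDb0 DP hDPle hwin hdisp hroom3
  have hPV3 := hpath_jv3Sq_of_hdisp F γ b₀ p₀ j Ts hjTs ρ ρ' hρm hρ'm hcT hcT' hposT hθT hχc hχ0 hχsupp hχpos τ Φ J hΦm hJm CJ hJle hpos
    c hc hθj Db rc hrc.le hDb0 DP hDPle hwin hdisp hroom3
  have hSL := hsqpath_l2j_of_hdisp F γ b₀ p₀ j Ts hjTs ρ ρ' hρm hρ'm hcT hcT' hposT hθT hχc hχ0 hχsupp hχpos τ Φ J hΦm hJm CJ hJle hpos
    c hc hθj Db rc hrc.le hDb0 DP hDPle hwin hdisp hroom3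
  have hSV4 := hsqpath_jv4_of_hdisp F γ b₀ p₀ j Ts hjTs ρ ρ' hρm hρ'm hcT hcT' hposT hθT hχc hχ0 hχsupp hχpos τ Φ J hΦm hJm CJ hJle hpos
    c hc hθj Db rc hrc.le hDb0 DP hDPle hwin hdisp hroom3
  have hJV0 := jv0ClauseSq_of_hdisp F γ b₀ p₀ j Ts hjTs ρ ρ' hρm hρ'm hcT hcT' hposT hθT hθj hχc hχ0 hχsupp hχpos τ Φ J hΦm hJm CJ hJle hpos
    c Db rc hc hrc.le hDb0 DP hDPle hdisp hroom3
  refine ⟨Z, instZ, τ, Φ, J, S, π, hτ, hΦm, hJm, hSm, hS, hsec, hdis, hcont, hJle, hpos, hπ1, hπ2, ?_, ?_⟩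
  · -- the (H) block
    intro k w hkw0 hwle hk0 hkrow hksq
    obtain ⟨hcurvT, hlawXL, -, -, -⟩ := hseedgrp k w hkw0 hwle hk0 hkrow hksq
    refine ⟨?_, ?_, ?_⟩
    · -- (JT-h)sq ⟸ (I-geo)sq + (I-curv) by ✓p819624 (law point `Y`)
      intro t ht0 ht1
      obtain ⟨kG, kB, ES, hkG0, hkB0, hES, hmass, hGoodAll⟩ := hcurvT t ht0 ht1
      refine ⟨fun B B' => kG B B' + ES * kB B B', fun B B' => add_nonneg (hkG0 B B') (mul_nonneg hES (hkB0 B B')), hmass, ?_⟩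
      intro B B' m m' U V W Y hm hm' hU hV hW hY hVU hVb hWU hWb hYV hYb
      obtain ⟨Good, hGood, htail, hG, hcrude⟩ := hGoodAll Y hY
      exact jtBracket_sq_of_hdisp_crude F γ b₀ p₀ j Ts hjTs ρ ρ' hρm hρ'm hcT hcT' hposT hθT hθj hχc hχ0 hχsupp hχpos
        τ Φ J hΦm hJm CJ hJle hpos t hc B B' m m' U V W Y Y hm hm' hU hV hW hY hY hVU hVb hWU hWb hYV hYb
        Db hrc.le hDb0 DP hDPle hdisp hroom3 (Or.inr (Or.inr (Or.inr rfl))) Good hGood (hkG0 B B')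
        (hG B B' m m' U V W Y hm hm' hU hV hW hY hVU hVb hWU hWb hYV hYb (Or.inr (Or.inr (Or.inr rfl))))
        (hkB0 B B') hES (hcrude B B' m m' U V W Y hm hm' hU hV hW hY hVU hVb hWU hWb hYV hYb (Or.inr (Or.inr (Or.inr rfl)))) htail
    · -- (L1ʲ-h)sq ⟸ (I-law-X)sq by ✓p819236 `l1jSq_of_ilaw` + ✓p819333
      intro t ht0 ht1
      obtain ⟨hX, -⟩ := hlawXL t ht0 ht1
      exact l1jSq_of_ilawAE F γ b₀ p₀ j Ts ρ ρ' τ Φ J κ rc w NX δX t (hw0 t) hmF hΦm hJm hρm hρ'm hχc (hPX t) hX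
    · -- (L2ʲ-h) ⟸ (I-law-L) by ✓p817463 `l2j_of_ilaw` + ✓p819333
      intro t ht0 ht1
      obtain ⟨-, hL⟩ := hlawXL t ht0 ht1
      exact l2j_of_ilawAE F γ b₀ p₀ j Ts ρ ρ' τ Φ J κ rc w NL δL t (hw0 t) hmF hΦm hJm hρm hρ'm hχc (hSL t) hL
  · -- the (HV′) block
    intro k w hkw0 hwle hk0 hkrow hksq
    obtain ⟨-, -, hV3, hV4, Prof, 𝒢, ωf, NG, NG₀, K, ωX, Ncol, Nrow, K2, NY, x₀, hG0, hωf, hNG, hGrow, hNG₀, hGrow₀, hCov, hK0, hωX, hNrow, hKcol,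
      hKrow, htri, hProf1, hK20, hK2mass, hProf2, hx₀, hProf0, hM2, hM1⟩ := hseedgrp k w hkw0 hwle hk0 hkrow hksq
    refine ⟨hJV0, ?_, ?_, ?_, ?_⟩
    · exact jv1ClauseSq_of_covKernel_profiles τ (fun X z => Real.log (ρ Ts (Φ (X, z))) - Real.log (ρ' Ts (Φ (X, z))))
        (fun t Xw z => (wgt F γ b₀ p₀ j Ts ρ ρ' τ Φ J t) Xw z) (θBal F.L γ b₀ p₀ j / 4) rc κ (NV1 * ((((F.L : ℝ) ^ j / γ) * θBal F.L γ b₀ p₀ j ^ 2) / (((F.L : ℝ) ^ Ts / γ) * θBal F.L γ b₀ p₀ Ts ^ 2)) * w * (w / (((F.L : ℝ) ^ Ts / γ) * θBal F.L γ b₀ p₀ Ts ^ 2)) + δV1 j * (((F.L : ℝ) ^ j / γ) * θBal F.L γ b₀ p₀ j ^ 2)) hθ4 Prof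
        hJV0 𝒢 NG₀ hG0 hNG₀ hGrow₀ hCov K2 NY hK20 hK2mass hProf2 x₀ hx₀ hProf0 hM1
    · exact jv2ClauseSq_of_covKernel_profiles τ (fun X z => Real.log (ρ Ts (Φ (X, z))) - Real.log (ρ' Ts (Φ (X, z))))
        (fun t Xw z => (wgt F γ b₀ p₀ j Ts ρ ρ' τ Φ J t) Xw z) (θBal F.L γ b₀ p₀ j / 4) rc κ (NV2 * ((((F.L : ℝ) ^ j / γ) * θBal F.L γ b₀ p₀ j ^ 2) / (((F.L : ℝ) ^ Ts / γ) * θBal F.L γ b₀ p₀ Ts ^ 2)) * w * (w / (((F.L : ℝ) ^ Ts / γ) * θBal F.L γ b₀ p₀ Ts ^ 2)) + δV2 j * (((F.L : ℝ) ^ j / γ) * θBal F.L γ b₀ p₀ j ^ 2)) hθ4 Prof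
        𝒢 ωf NG hG0 hωf hNG hGrow hCov K ωX Ncol Nrow hK0 hωX hNrow hKcol hKrow htri hProf1 hM2
    · -- (JV3-h′)sq ⟸ (I-law-V3)sq by ✓p819236 `jv3Sq_of_ilaw` + ✓p819333
      exact jv3Sq_of_ilawAE F γ b₀ p₀ j Ts ρ ρ' τ Φ J κ rc w NV3 δV3 hw0 hmF hΦm hJm hρm hρ'm hχc hPV3 hV3
    · -- (JV4-h′) ⟸ (I-law-V4) by ✓p817560 `jv4_of_ilaw` + ✓p819333
      exact jv4_of_ilawAE F γ b₀ p₀ j Ts ρ ρ' τ Φ J κ rc w NV4 δV4 hw0 hmF hΦm hJm hρm hρ'm hχc hSV4 hV4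

end Summit.QuantumFields.YangMills.Theorems.OrganTangentSpreadFibreLawHJsqOfDischargeInputsSqV04

end
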